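import Mathlib

/-!
# Tier3TwistRelation — the EXACT FORM of (R2-exact) and its invariances (T3.5 for T3.1; PERIOD.md §5(C), §5(B))

Blind re-derivation cell `pub-hodge-repro`, seat `t3-p1` (Tier 3, T3.5 Lean item beside T3.1). Target tree path
`lean/Summits/Ventures/HodgeRepro/Tier3TwistRelation.lean`; Mathlib only; theorems only (no definition, instance,
notation or macro).

`proofs/t3-p1/PERIOD.md` §5(C) states the residual (R2) of the period closer in its exact form — for subsets
`S_j := {x ∈ Ξ_𝔭 : ε(χ′_j x) = +1 ∧ L(½, χ′_j x) ≠ 0}` of the commutative group `Ξ_𝔭` of finite-order anticyclotomic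
characters (a `p`-group, `p` odd),

  (R2-exact)  `∃ x_j ∈ S_j (j = 0,1,2,3) with x₀ x₁ = x₂ x₃`,

and surrounds it with six ELEMENTARY sentences that no kernel module twins yet (t3-p4's `Tier3PairCombinatorics`,
row §8 of route/TIER3.md, twins only the SUFFICIENT clause «one `S_j` cofinite + one infinite»). This file is those
sentences, in the vocabulary of `Tier3PairCombinatorics` (four subsets of a commutative group, pointwise products):

* `exists_mul_eq_mul_iff_inter_nonempty` — «equivalently `S₀·S₁ ∩ S₂·S₃ ≠ ∅` (product sets in the abelian group
  `Ξ_𝔭`)»;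
* `exists_mul_eq_mul_iff_forced` — «Three twists are free, the fourth is forced: `x₀ ∈ S₀`, `x₂ ∈ S₂`, `x₃ ∈ S₃` …
  then `x₁ = x₂ x₃ / x₀` must lie in `S₁`»;
* `not_exists_mul_eq_mul_of_subset_subgroup`, `exists_infinite_no_solution`,
  `not_forall_exists_mul_eq_mul_of_infinite` — «four ‹infinitely many› statements do not suffice formally»: three
  infinite sets inside a subgroup `H` and one inside a coset `g • H`, `g ∉ H`, admit no solution; a witness of exactly
  that shape lives in the infinite abelian group of exponent 3 `Multiplicative (ℕ →₀ ZMod 3)` (`witness_pow_three`: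
  every element has `x ^ 3 = 1`, as every element of `Ξ_𝔭` has `p`-power order), so the implication «all four
  infinite ⇒ (R2-exact)» is not a formal consequence of infinitude — the cofinite quantifier of
  `Tier3PairCombinatorics.exists_mul_eq_mul_of_cofinite_of_infinite` is needed;
* `setOf_inv_mul_eq_smul`, `exists_mul_eq_mul_smul_iff`, `exists_mul_eq_mul_setOf_inv_mul_iff` — «The
  splitting-character freedom — `χ_W ↦ χ_W·t` … — shifts all four `χ_j′` by the same `t⁻¹` and leaves the relation
  unchanged»: replacing `χ′_j` by `χ′_j t⁻¹` replaces the predicate `P_j(x)` by `P_j(t⁻¹ x)`, i.e. `S_j` by the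
  translate `t • S_j`, and (R2-exact) for the translates is equivalent to (R2-exact) for the `S_j`;
* `exists_mul_eq_mul_of_inter_nonempty_of_inter_nonempty` (and the primed mirror) — «Alternative choices
  `(x₀ = x₂, x₁ = x₃)` or `(x₀ = x₃, x₁ = x₂)` satisfy the relation automatically and turn (R2-exact) into two
  intersections `S₀ ∩ S₂ ≠ ∅`, `S₁ ∩ S₃ ≠ ∅` (resp. `S₀ ∩ S₃`, `S₁ ∩ S₂`)»;
* `eq_of_mul_eq_of_mul_eq`, `mul_eq_mul_iff_of_mul_eq_mul` — the first sentences of §5(C): «(1) for `T` and for `T′`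
  forces N2: `χ₀χ₁ = χ₂χ₃`» (the same `β` and splitting data on ONE `τ`: `β = c·(χ₀χ₁)|_Z = c·(χ₂χ₃)|_Z`), and «With
  the route's twist freedom `χ_j ↦ χ_j ν_j` … one relation survives: `ν₀ν₁ = ν₂ν₃`»;
* `restrict_mul_inv_eq` — §5(B): «`χ_j′` is unitary with `χ_j′|_{𝔸_k^×} = χ_W⁻¹|_{𝔸_k^×} = ε_{K/k}` (`χ_W|_{k^×} = ε`;
  `(χ_j)_K` is trivial on `k^×`): conjugate-symplectic» — for characters `χ_K`, `χ_W` of a group `G` with values in a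
  commutative group, trivial resp. equal to `ε` on a subgroup `A`, with `ε² = 1`, the restriction of `χ_K · χ_W⁻¹`
  to `A` is `ε`.

What stays on the page (not in this file): what the sets `S_j` ARE (root numbers and central `L`-values of the
twisted corner characters — §5(A)/(B)/(D), T3.2's lane), that `Ξ_𝔭` is the group of finite-order anticyclotomic
characters, and the sentence «(R2-exact) below is insensitive to `κ`». Nothing here is about `L`-values or characters;
HC_CM is NOT proved by anyone in this repository.
-/

set_option autoImplicit false

open scoped Pointwise

namespace HodgeRepro.T3P1.TwistRelation

section CommGroup

variable {Ξ : Type*} [CommGroup Ξ]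

/-- **The product-set form.** `∃ x_j ∈ S_j, x₀ x₁ = x₂ x₃` iff the pointwise products `S₀ * S₁` and `S₂ * S₃` meet
(PERIOD.md §5(C): «equivalently `S₀·S₁ ∩ S₂·S₃ ≠ ∅` (product sets in the abelian group `Ξ_𝔭`)»). -/
theorem exists_mul_eq_mul_iff_inter_nonempty (S₀ S₁ S₂ S₃ : Set Ξ) :
    (∃ x₀ ∈ S₀, ∃ x₁ ∈ S₁, ∃ x₂ ∈ S₂, ∃ x₃ ∈ S₃, x₀ * x₁ = x₂ * x₃) ↔
      ((S₀ * S₁) ∩ (S₂ * S₃)).Nonempty := by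
  constructor
  · rintro ⟨x₀, h₀, x₁, h₁, x₂, h₂, x₃, h₃, h⟩
    exact ⟨x₀ * x₁, Set.mul_mem_mul h₀ h₁, h ▸ Set.mul_mem_mul h₂ h₃⟩
  · rintro ⟨z, hz₀₁, hz₂₃⟩
    obtain ⟨x₀, h₀, x₁, h₁, rfl⟩ := Set.mem_mul.mp hz₀₁
    obtain ⟨x₂, h₂, x₃, h₃, h⟩ := Set.mem_mul.mp hz₂₃
    exact ⟨x₀, h₀, x₁, h₁, x₂, h₂, x₃, h₃, h.symm⟩

/-- **Three twists are free, the fourth is forced.** `∃ x_j ∈ S_j, x₀ x₁ = x₂ x₃` iff there are `x₀ ∈ S₀`, `x₂ ∈ S₂`,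
`x₃ ∈ S₃` with the forced fourth `x₂ x₃ / x₀` in `S₁` (PERIOD.md §5(C)). -/
theorem exists_mul_eq_mul_iff_forced (S₀ S₁ S₂ S₃ : Set Ξ) :
    (∃ x₀ ∈ S₀, ∃ x₁ ∈ S₁, ∃ x₂ ∈ S₂, ∃ x₃ ∈ S₃, x₀ * x₁ = x₂ * x₃) ↔
      ∃ x₀ ∈ S₀, ∃ x₂ ∈ S₂, ∃ x₃ ∈ S₃, x₂ * x₃ / x₀ ∈ S₁ := by
  constructor
  · rintro ⟨x₀, h₀, x₁, h₁, x₂, h₂, x₃, h₃, h⟩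
    refine ⟨x₀, h₀, x₂, h₂, x₃, h₃, ?_⟩
    have hx₁ : x₂ * x₃ / x₀ = x₁ := by rw [← h, mul_div_cancel_left]
    rwa [hx₁]
  · rintro ⟨x₀, h₀, x₂, h₂, x₃, h₃, h₁⟩
    exact ⟨x₀, h₀, x₂ * x₃ / x₀, h₁, x₂, h₂, x₃, h₃, mul_div_cancel x₀ (x₂ * x₃)⟩

/-- **Three sets in a subgroup and one in a non-trivial coset: no solution.** If `S₀, S₁, S₂ ⊆ H` and
`S₃ ⊆ g • H` with `g ∉ H`, then `x₀ x₁ ∈ H` while `x₂ x₃ ∈ g • H`, and the two cosets are disjoint. This is the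
mechanism behind «four ‹infinitely many› statements do not suffice formally» (PERIOD.md §5(C)). -/
theorem not_exists_mul_eq_mul_of_subset_subgroup (H : Subgroup Ξ) {g : Ξ} (hg : g ∉ H)
    {S₀ S₁ S₂ S₃ : Set Ξ} (h₀ : S₀ ⊆ H) (h₁ : S₁ ⊆ H) (h₂ : S₂ ⊆ H) (h₃ : S₃ ⊆ g • (H : Set Ξ)) :
    ¬ ∃ x₀ ∈ S₀, ∃ x₁ ∈ S₁, ∃ x₂ ∈ S₂, ∃ x₃ ∈ S₃, x₀ * x₁ = x₂ * x₃ := by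
  rintro ⟨x₀, hx₀, x₁, hx₁, x₂, hx₂, x₃, hx₃, h⟩
  obtain ⟨y, hy, rfl⟩ := Set.mem_smul_set.mp (h₃ hx₃)
  apply hg
  have hg' : g = (x₀ * x₁) / (x₂ * y) := by
    rw [h, smul_eq_mul, mul_div_mul_left_eq_div, mul_div_cancel_right]
  rw [hg']
  exact H.div_mem (H.mul_mem (h₀ hx₀) (h₁ hx₁)) (H.mul_mem (h₂ hx₂) hy)

/-- **The common-twist invariance.** Translating all four sets by the same `t` (the sets `S_j` of PERIOD.md §5(C) move
to `t • S_j` when every `χ_j′` is replaced by `χ_j′ t⁻¹`) leaves (R2-exact) unchanged: `(t x₀)(t x₁) = (t x₂)(t x₃)`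
iff `x₀ x₁ = x₂ x₃`. -/
theorem exists_mul_eq_mul_smul_iff (t : Ξ) (S₀ S₁ S₂ S₃ : Set Ξ) :
    (∃ x₀ ∈ t • S₀, ∃ x₁ ∈ t • S₁, ∃ x₂ ∈ t • S₂, ∃ x₃ ∈ t • S₃, x₀ * x₁ = x₂ * x₃) ↔
      ∃ x₀ ∈ S₀, ∃ x₁ ∈ S₁, ∃ x₂ ∈ S₂, ∃ x₃ ∈ S₃, x₀ * x₁ = x₂ * x₃ := by
  constructor
  · rintro ⟨_, ⟨x₀, h₀, rfl⟩, _, ⟨x₁, h₁, rfl⟩, _, ⟨x₂, h₂, rfl⟩, _, ⟨x₃, h₃, rfl⟩, h⟩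
    refine ⟨x₀, h₀, x₁, h₁, x₂, h₂, x₃, h₃, ?_⟩
    simp only [smul_eq_mul] at h
    rw [mul_mul_mul_comm, mul_mul_mul_comm t x₂] at h
    exact mul_left_cancel h
  · rintro ⟨x₀, h₀, x₁, h₁, x₂, h₂, x₃, h₃, h⟩
    refine ⟨t • x₀, Set.smul_mem_smul_set h₀, t • x₁, Set.smul_mem_smul_set h₁, t • x₂,
      Set.smul_mem_smul_set h₂, t • x₃, Set.smul_mem_smul_set h₃, ?_⟩
    simp only [smul_eq_mul]
    rw [mul_mul_mul_comm, h, mul_mul_mul_comm]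

/-- The set cut out by a predicate at the shifted argument `t⁻¹ x` is the translate by `t` of the set cut out by the
predicate: `S_j(χ_j′ t⁻¹) = t • S_j(χ_j′)` in PERIOD.md §5(C)'s notation, since `(χ_j′ t⁻¹) x = χ_j′ (t⁻¹ x)`. -/
theorem setOf_inv_mul_eq_smul (t : Ξ) (P : Ξ → Prop) : {x | P (t⁻¹ * x)} = t • {x | P x} := by
  ext x
  constructor
  · intro hx
    exact ⟨t⁻¹ * x, hx, show t • (t⁻¹ * x) = x by rw [smul_eq_mul, mul_inv_cancel_left]⟩
  · rintro ⟨y, hy, rfl⟩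
    show P (t⁻¹ * (t • y))
    rwa [smul_eq_mul, inv_mul_cancel_left]

/-- **The common-twist invariance, predicate form.** With `S_j = {x | P_j x}` and the shifted sets
`{x | P_j (t⁻¹ x)}` (every `χ_j′` replaced by `χ_j′ t⁻¹`), (R2-exact) for the shifted sets is equivalent to (R2-exact)
for the original ones (PERIOD.md §5(C): «shifts all four `χ_j′` by the same `t⁻¹` and leaves the relation unchanged»). -/
theorem exists_mul_eq_mul_setOf_inv_mul_iff (t : Ξ) (P₀ P₁ P₂ P₃ : Ξ → Prop) :
    (∃ x₀ ∈ {x | P₀ (t⁻¹ * x)}, ∃ x₁ ∈ {x | P₁ (t⁻¹ * x)}, ∃ x₂ ∈ {x | P₂ (t⁻¹ * x)},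
        ∃ x₃ ∈ {x | P₃ (t⁻¹ * x)}, x₀ * x₁ = x₂ * x₃) ↔
      ∃ x₀ ∈ {x | P₀ x}, ∃ x₁ ∈ {x | P₁ x}, ∃ x₂ ∈ {x | P₂ x}, ∃ x₃ ∈ {x | P₃ x}, x₀ * x₁ = x₂ * x₃ := by
  rw [setOf_inv_mul_eq_smul t P₀, setOf_inv_mul_eq_smul t P₁, setOf_inv_mul_eq_smul t P₂,
    setOf_inv_mul_eq_smul t P₃]
  exact exists_mul_eq_mul_smul_iff t _ _ _ _

/-- **Two pair intersections suffice** (the choice `x₀ = x₂`, `x₁ = x₃` of PERIOD.md §5(C)): `S₀ ∩ S₂ ≠ ∅` and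
`S₁ ∩ S₃ ≠ ∅` give `x_j ∈ S_j` with `x₀ x₁ = x₂ x₃`. -/
theorem exists_mul_eq_mul_of_inter_nonempty_of_inter_nonempty {S₀ S₁ S₂ S₃ : Set Ξ}
    (h₀₂ : (S₀ ∩ S₂).Nonempty) (h₁₃ : (S₁ ∩ S₃).Nonempty) :
    ∃ x₀ ∈ S₀, ∃ x₁ ∈ S₁, ∃ x₂ ∈ S₂, ∃ x₃ ∈ S₃, x₀ * x₁ = x₂ * x₃ := by
  obtain ⟨a, ha₀, ha₂⟩ := h₀₂
  obtain ⟨b, hb₁, hb₃⟩ := h₁₃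
  exact ⟨a, ha₀, b, hb₁, a, ha₂, b, hb₃, rfl⟩

/-- **Two pair intersections suffice, the mirror** (the choice `x₀ = x₃`, `x₁ = x₂`): `S₀ ∩ S₃ ≠ ∅` and `S₁ ∩ S₂ ≠ ∅`
give `x_j ∈ S_j` with `x₀ x₁ = x₂ x₃`. -/
theorem exists_mul_eq_mul_of_inter_nonempty_of_inter_nonempty' {S₀ S₁ S₂ S₃ : Set Ξ}
    (h₀₃ : (S₀ ∩ S₃).Nonempty) (h₁₂ : (S₁ ∩ S₂).Nonempty) :
    ∃ x₀ ∈ S₀, ∃ x₁ ∈ S₁, ∃ x₂ ∈ S₂, ∃ x₃ ∈ S₃, x₀ * x₁ = x₂ * x₃ := by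
  obtain ⟨a, ha₀, ha₃⟩ := h₀₃
  obtain ⟨b, hb₁, hb₂⟩ := h₁₂
  exact ⟨a, ha₀, b, hb₁, b, hb₂, a, ha₃, mul_comm a b⟩

/-- **N2 is forced.** TP1's compatibility (1) for `T` and for `T′` on ONE `τ` — the same `β` and the same splitting
data `c := (χ_W⁻² χ_V) ∘ j⁻¹` — reads `β = c · (χ₀χ₁)|_Z` and `β = c · (χ₂χ₃)|_Z`; cancelling `c` gives
`χ₀χ₁ = χ₂χ₃` (PERIOD.md §5(C), first sentence). -/
theorem eq_of_mul_eq_of_mul_eq {β c a b : Ξ} (hT : β = c * a) (hT' : β = c * b) : a = b :=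
  mul_left_cancel (hT.symm.trans hT')

/-- **One relation survives among the twists.** Under N2 (`χ₀χ₁ = χ₂χ₃`), the twisted corner characters
`χ_j ν_j` satisfy N2 iff `ν₀ν₁ = ν₂ν₃` (PERIOD.md §5(C): «one relation survives: `ν₀ν₁ = ν₂ν₃`»). -/
theorem mul_eq_mul_iff_of_mul_eq_mul {χ₀ χ₁ χ₂ χ₃ : Ξ} (hN2 : χ₀ * χ₁ = χ₂ * χ₃) (ν₀ ν₁ ν₂ ν₃ : Ξ) :
    (χ₀ * ν₀) * (χ₁ * ν₁) = (χ₂ * ν₂) * (χ₃ * ν₃) ↔ ν₀ * ν₁ = ν₂ * ν₃ := by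
  rw [mul_mul_mul_comm, mul_mul_mul_comm χ₂, hN2]
  exact mul_left_cancel_iff

end CommGroup

section Witness

/-- Every element of `Multiplicative (ℕ →₀ ZMod 3)` has `x ^ 3 = 1`: the witness group is an abelian group of
exponent 3 (every element of `p`-power order, `p = 3` odd — the shape of `Ξ_𝔭`). -/
theorem witness_pow_three (x : Multiplicative (ℕ →₀ ZMod 3)) : x ^ 3 = 1 := by
  rw [← ofAdd_toAdd x, ← ofAdd_nsmul, ← ofAdd_zero]
  congr 1
  ext n
  simp only [Finsupp.smul_apply, Finsupp.coe_zero, Pi.zero_apply, nsmul_eq_mul]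
  rw [show ((3 : ℕ) : ZMod 3) = 0 from ZMod.natCast_self 3, zero_mul]

/-- **Four infinite sets with no solution.** In the infinite abelian group of exponent 3
`Multiplicative (ℕ →₀ ZMod 3)`: `S₀ = S₁ = S₂ = H := {x : x 0 = 0}` (a subgroup of index 3) and `S₃ = g • H` with
`g := ofAdd (single 0 1) ∉ H`. All four are infinite and `x₀ x₁ ∈ H`, `x₂ x₃ ∈ g • H` never meet — PERIOD.md §5(C)'s
«four ‹infinitely many› statements do not suffice formally». -/
theorem exists_infinite_no_solution :
    ∃ S₀ S₁ S₂ S₃ : Set (Multiplicative (ℕ →₀ ZMod 3)),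
      S₀.Infinite ∧ S₁.Infinite ∧ S₂.Infinite ∧ S₃.Infinite ∧
        ¬ ∃ x₀ ∈ S₀, ∃ x₁ ∈ S₁, ∃ x₂ ∈ S₂, ∃ x₃ ∈ S₃, x₀ * x₁ = x₂ * x₃ := by
  -- the subgroup `H = ker (evaluation at 0)` of the multiplicative group
  let H : Subgroup (Multiplicative (ℕ →₀ ZMod 3)) :=
    AddSubgroup.toSubgroup (AddMonoidHom.ker (Finsupp.applyAddHom (0 : ℕ) : (ℕ →₀ ZMod 3) →+ ZMod 3))
  have memH : ∀ x : Multiplicative (ℕ →₀ ZMod 3), x ∈ H ↔ (Multiplicative.toAdd x) 0 = 0 := by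
    intro x
    rfl
  let g : Multiplicative (ℕ →₀ ZMod 3) := Multiplicative.ofAdd (Finsupp.single 0 1)
  have hg : g ∉ H := by
    rw [memH]
    simp [g]
  -- `H` is infinite: it contains `ofAdd (single (n + 1) 1)` for every `n`
  have hHinf : (H : Set (Multiplicative (ℕ →₀ ZMod 3))).Infinite := by
    refine Set.infinite_of_injective_forall_mem
      (f := fun n : ℕ => Multiplicative.ofAdd (Finsupp.single (n + 1) (1 : ZMod 3))) ?_ ?_
    · intro m n hmn
      have h := Finsupp.single_left_injective (α := ℕ) (M := ZMod 3) one_ne_zero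
        (Multiplicative.ofAdd.injective hmn)
      exact Nat.succ_injective h
    · intro n
      show Multiplicative.ofAdd (Finsupp.single (n + 1) (1 : ZMod 3)) ∈ H
      rw [memH]
      simp
  refine ⟨H, H, H, g • (H : Set (Multiplicative (ℕ →₀ ZMod 3))), hHinf, hHinf, hHinf, ?_, ?_⟩
  · exact hHinf.image (MulAction.injective g).injOn
  · exact not_exists_mul_eq_mul_of_subset_subgroup H hg le_rfl le_rfl le_rfl le_rfl

/-- **The formal implication fails.** «All four `S_j` infinite ⇒ (R2-exact)» is false in the abelian group of
exponent 3 `Multiplicative (ℕ →₀ ZMod 3)` — so (R2-exact) is not a formal consequence of four «infinitely many»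
statements; the cofinite quantifier of `Tier3PairCombinatorics` is what closes it (PERIOD.md §5(C)). -/
theorem not_forall_exists_mul_eq_mul_of_infinite :
    ¬ ∀ S₀ S₁ S₂ S₃ : Set (Multiplicative (ℕ →₀ ZMod 3)),
      S₀.Infinite → S₁.Infinite → S₂.Infinite → S₃.Infinite →
        ∃ x₀ ∈ S₀, ∃ x₁ ∈ S₁, ∃ x₂ ∈ S₂, ∃ x₃ ∈ S₃, x₀ * x₁ = x₂ * x₃ := by
  intro hall
  obtain ⟨S₀, S₁, S₂, S₃, h₀, h₁, h₂, h₃, hno⟩ := exists_infinite_no_solution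
  exact hno (hall S₀ S₁ S₂ S₃ h₀ h₁ h₂ h₃)

end Witness

section Restriction

variable {G C : Type*} [Group G] [CommGroup C]

/-- **§5(B): the twisted corner character is conjugate-symplectic.** If `χ_K` is trivial on the subgroup `A` and
`χ_W` restricts to `ε` on `A` with `ε² = 1`, then `χ_K · χ_W⁻¹` restricts to `ε⁻¹ = ε` on `A`
(PERIOD.md §5(B): «`χ_j′|_{𝔸_k^×} = χ_W⁻¹|_{𝔸_k^×} = ε_{K/k}`»). -/
theorem restrict_mul_inv_eq (A : Subgroup G) (χK χW : G →* C) (ε : A →* C)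
    (hK : χK.restrict A = 1) (hW : χW.restrict A = ε) (hε : ε * ε = 1) :
    (χK * χW⁻¹).restrict A = ε := by
  ext a
  have h1 : χK a = 1 := by
    have := congrArg (fun f : A →* C => f a) hK
    simpa using this
  have h2 : χW a = ε a := by
    have := congrArg (fun f : A →* C => f a) hW
    simpa using this
  have h3 : ε a * ε a = 1 := by
    have := congrArg (fun f : A →* C => f a) hε
    simpa using this
  simp only [MonoidHom.restrict_apply, MonoidHom.mul_apply, MonoidHom.inv_apply, h1, h2, one_mul]
  exact inv_eq_of_mul_eq_one_right h3

end Restriction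

end HodgeRepro.T3P1.TwistRelation
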